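/-
Copyright (c) 2026. All rights reserved.
Released under Apache 2.0 license as described in the file LICENSE.
Authors: abc-iut cell, seat abc-iut-w6-d023 (gen 3; block C / W6).
-/
import Literature.AnabelianGeometry.AbsoluteAnabelian.AbsTopIII.FrobeniusPictureMLFCompatTwistedToyTelecore
import HarnessLib

/-!
# [AbsTopIII] Cor. 3.6 (iii) at the twisted toy datum, II: the telecore half of the literal clause HOLDS —
# all three typed compatibility clauses hold where F-0360 fails

S. Mochizuki, *Topics in Absolute Anabelian Geometry III* [MochizukiAbsTopIII2015] (kurims `paper:url-5493eb38cbb7`):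
Cor. 3.6 (iii) p. 80 ("[the family of homotopies of `𝔖_log`] is compatible with the families of homotopies that
constitute the core and telecore structures of (i), (ii)"), proof p. 81 l. 21–26; Def. 3.5 (ii), (iv) pp. 75–76.

PROOF-ONLY-IN-SPIRIT sequel (the definitions are the embeddings `toCore`, `ell` and two families) of
`FrobeniusPictureMLFCompatTwistedToyTelecore` (this seat).  On the telecore diagram `𝒟_An` of the twisted toy:

* `TwistedToy.baseFamily` — the boundary set `E₀` on telecore-free paths = the glued set `GlueE` of `𝒟` read along
  `Γ⃗_𝒮 → 𝒟_{≤5} ∪ {Anab} ↪ 𝒟` (`toCore`, abc-iut-L4-t5's `embCore5`); **`TwistedToy.tmaster τ`** — the master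
  family: boundary set = abc-iut-w6-d025's glued set `TGlueE E₀` (`FrobeniusPictureMLFLogTeleBoundary`:
  `E₀`-images, all pairs into `Anab`, same-edge telecore pairs; saturated), homotopies twisted;
* `jfam_compatibleAlong_tmaster` — the telecore family `𝒥` lies in it (pairs through `Anab` are glued pairs);
* `tmaster_E_iff` — along `𝒟_{≤3} ↪ 𝒟_An` (`embLogTele = jS ∘ ell`) its pairs are exactly the images of glued
  pairs of `𝒟`, hence (`pullLogTele_tmaster_E_iff`) of the `E_log` pairs; `pullLogTele_tmaster_logPinned` — pinned
  to `ι_×`, `ι_{log,⋎}` (= `g`); so the pullback IS an `𝔖_log` family (`pullLogTele_tmaster_isLogObservableFamily`);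
* **`TwistedToy.logObsCompatTelecoreStmt τ : datum.LogObsCompatTelecoreStmt τ`** for EVERY telecore datum `τ`;
* **`exists_logObsCompat_all_not_iotaOverGaloisStmt`**: ONE datum at which the literal (iii) cores clause, the
  literal (iii) telecore clause (for all `τ`) and the (v) third sentence HOLD while F-0360 `IotaOverGaloisStmt`
  FAILS; schema form `not_forall_iotaOverGaloisStmt_of_logObsCompatTelecoreStmt`.

UPSHOT for the node ledger (AbsTopIII:Cor3.6(iii)/(v), Cor4.5(iii)/(v)): every typed LITERAL compatibility clause is
STRICTLY WEAKER than the recorded content F-0360; F-0360 is sufficient (abc-iut-w5-d053 / abc-iut-w6-d023 gen 2 /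
abc-iut-w6-d025) and not necessary (this series) for each.  HONEST FRAMING: bookkeeping over the typed data and a
toy datum (toy ≠ model); refereed pre-IUT material; nothing here bears on [IUTchIII] Cor. 3.12 or takes a side;
typed ≠ proved.
-/

namespace Literature.AnabelianGeometry.AbsoluteAnabelian

open _root_.CategoryTheory _root_.Quiver

namespace LogFrobeniusData

open DiagramOfCategories

namespace TwistedToy

variable (τ : datum.TelecoreData)

/-! ### the master family on `𝒟_An`: boundary set `TGlueE` of the glued set, twisted homotopies -/

/-- The telecore-free sub-graph `Γ⃗_𝒮` of `Γ⃗_{𝒟_An}` IS the graph of the observable `(𝒟_{≤5}, Anab)` (identity on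
vertices and edges; Def. 3.5 (iv) (a)). [cite: MochizukiAbsTopIII2015, Definition 3.5 (iv) p.76] -/
def toCore : FVtx.{0} ⥤q coreShape5.{0}.Vertex where
  obj x := x.v
  map {x y} e := match x, y, e with
    | ⟨ExtVertex.base _⟩, ⟨ExtVertex.base _⟩, e => e
    | ⟨ExtVertex.base _⟩, ⟨ExtVertex.obs⟩, i => i
    | ⟨ExtVertex.obs⟩, ⟨ExtVertex.base _⟩, e => PEmpty.elim e
    | ⟨ExtVertex.obs⟩, ⟨ExtVertex.obs⟩, e => PEmpty.elim e

/-- The boundary set `E₀` on telecore-free paths, packaged as the pullback of the twisted family of `𝒟` along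
`Γ⃗_𝒮 → Γ⃗_{𝒟_{≤5} ∪ {Anab}} ↪ Γ⃗_𝒟` (so `E₀` = the glued set `GlueE` read there, saturated).
[cite: MochizukiAbsTopIII2015, Corollary 3.6 (iii) p.80] -/
def baseFamily : ((datum.diagram.comapAlong embCore5).comapAlong toCore).HomotopyFamily :=
  (family.comap embCore5).comap toCore

/-- `E₀ (u, v) ↔ GlueE (embCore5 (toCore u), embCore5 (toCore v))` (definitional). [cite: MochizukiAbsTopIII2015, Corollary 3.6 (iii) p.80] -/
theorem baseFamily_E_iff {x y : FVtx.{0}} (u v : Path x y) :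
    baseFamily.E u v ↔ datum.GlueE (embCore5.mapPath (toCore.mapPath u)) (embCore5.mapPath (toCore.mapPath v)) :=
  Iff.rfl

/-- **The master family on `𝒟_An`**: boundary set = abc-iut-w6-d025's glued set `TGlueE E₀`, homotopies twisted.
[cite: MochizukiAbsTopIII2015, Corollary 3.6 (iii) p.80] -/
def tmaster : (TD τ).HomotopyFamily :=
  tFamily τ (TGlueE baseFamily.E) (isSaturated_tGlueE baseFamily.isSaturated)

/-- **The telecore family `𝒥` is contained in the master family** (Def. 3.5 (ii) compatibility along the identity):
pairs through `Anab` are glued pairs, and both families carry the twisted homotopies. [cite: MochizukiAbsTopIII2015, Corollary 3.6 (iii) p.80] -/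
theorem jfam_compatibleAlong_tmaster : (telecore τ).Jfam.CompatibleAlong (𝟭q _) (tmaster τ) := by
  intro a b p q h
  rw [Prefunctor.mapPath_id, Prefunctor.mapPath_id]
  obtain ⟨d⟩ := (h : univE (· = (teleShape anJ.{0}).obs) p q)
  obtain ⟨w, hw, p₁, q₁, s, hp, hq⟩ := d
  subst hw
  subst hp
  subst hq
  exact ⟨tGlueE_postcomp_obs p₁ q₁ s, HEq.rfl⟩

/-! ### the pullback of the master family to `𝒟_{≤3}` is an `𝔖_log` family -/

/-- `𝒟_{≤3} → Γ⃗_𝒮`: abc-iut-L4-t5's embedding `embLogTele : 𝒟_{≤3} ↪ 𝒟_An` factored through the telecore-free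
sub-graph. [cite: MochizukiAbsTopIII2015, Corollary 3.6 (iii) p.80] -/
def ell : logObsShape.{0}.Vertex ⥤q FVtx.{0} where
  obj a := ⟨(embLogTele anJ.{0}).obj a⟩
  map {a b} e := match a, b, e with
    | ExtVertex.base _, ExtVertex.base _, e => e
    | ExtVertex.base ⟨.nexus, _⟩, ExtVertex.obs, i => i
    | ExtVertex.base ⟨.row1 _, _⟩, ExtVertex.obs, i => PEmpty.elim i
    | ExtVertex.base ⟨.third, _⟩, ExtVertex.obs, i => PEmpty.elim i
    | ExtVertex.base ⟨.fourth, _⟩, ExtVertex.obs, i => PEmpty.elim i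
    | ExtVertex.base ⟨.fifth, _⟩, ExtVertex.obs, i => PEmpty.elim i
    | ExtVertex.base ⟨.sixth, _⟩, ExtVertex.obs, i => PEmpty.elim i
    | ExtVertex.obs, ExtVertex.base _, j => PEmpty.elim j
    | ExtVertex.obs, ExtVertex.obs, e => PEmpty.elim e

/-- `jS ∘ ell = embLogTele` on edges. [folklore] -/
private theorem jS_map_ell_map : ∀ {a b : logObsShape.{0}.Vertex} (e : a ⟶ b),
    jS.map (ell.map e) = (embLogTele anJ.{0}).map e := by
  intro a b e
  rcases a with ⟨_ | _ | _ | _ | _ | _, _⟩ | _ <;> rcases b with ⟨_ | _ | _ | _ | _ | _, _⟩ | _ <;>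
    first | exact (PEmpty.elim e) | rfl

/-- `jS ∘ ell = embLogTele` on paths. [folklore] -/
private theorem jS_mapPath_ell {a b : logObsShape.{0}.Vertex} (p : Path a b) :
    jS.mapPath (ell.mapPath p) = (embLogTele anJ.{0}).mapPath p := by
  induction p with
  | nil => rfl
  | cons p e ih =>
    rw [Prefunctor.mapPath_cons, Prefunctor.mapPath_cons, Prefunctor.mapPath_cons, ih]
    exact congrArg _ (jS_map_ell_map e)

/-- `embCore5 ∘ toCore ∘ ell = embLog` on vertices. [folklore] -/
private theorem embCore5_toCore_ell_obj : ∀ (a : logObsShape.{0}.Vertex),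
    embCore5.obj (toCore.obj (ell.obj a)) = embLog.obj a := by
  intro a
  rcases a with ⟨_ | _ | _ | _ | _ | _, _⟩ | _ <;> rfl

/-- `embCore5 ∘ toCore ∘ ell = embLog` on edges (heterogeneously). [folklore] -/
private theorem embCore5_toCore_ell_map : ∀ {a b : logObsShape.{0}.Vertex} (e : a ⟶ b),
    HEq (embCore5.map (toCore.map (ell.map e))) (embLog.map e) := by
  intro a b e
  rcases a with ⟨_ | _ | _ | _ | _ | _, _⟩ | _ <;> rcases b with ⟨_ | _ | _ | _ | _ | _, _⟩ | _ <;>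
    first | exact (PEmpty.elim e) | exact HEq.rfl

/-- `Path.cons` respects heterogeneous equality of its arguments over equal endpoints. [folklore] -/
private theorem path_cons_heq {V : Type} [Quiver V] {a a' b b' c c' : V} (ha : a = a') (hb : b = b') (hc : c = c')
    {p : Path a b} {p' : Path a' b'} {e : b ⟶ c} {e' : b' ⟶ c'} (hp : HEq p p') (he : HEq e e') :
    HEq (p.cons e) (p'.cons e') := by
  subst ha hb hc
  rw [heq_iff_eq] at hp he
  subst hp he
  rfl

/-- `embCore5 ∘ toCore ∘ ell = embLog` on paths (heterogeneously). [folklore] -/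
private theorem embCore5_toCore_ell_mapPath {a b : logObsShape.{0}.Vertex} (p : Path a b) :
    HEq (embCore5.mapPath (toCore.mapPath (ell.mapPath p))) (embLog.mapPath p) := by
  induction p with
  | nil =>
    rw [Prefunctor.mapPath_nil, Prefunctor.mapPath_nil, Prefunctor.mapPath_nil, Prefunctor.mapPath_nil]
    rw [embCore5_toCore_ell_obj]
  | cons p e ih =>
    rw [Prefunctor.mapPath_cons, Prefunctor.mapPath_cons, Prefunctor.mapPath_cons, Prefunctor.mapPath_cons]
    exact path_cons_heq (embCore5_toCore_ell_obj _) (embCore5_toCore_ell_obj _) (embCore5_toCore_ell_obj _) ih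
      (embCore5_toCore_ell_map e)

/-- `GlueE` along heterogeneously equal pairs. [folklore] -/
private theorem glueE_heq_iff {a a' b b' : LFVertex} (ha : a = a') (hb : b = b') {P Q : Path a b}
    {P' Q' : Path a' b'} (hP : HEq P P') (hQ : HEq Q Q') : datum.GlueE P Q ↔ datum.GlueE P' Q' := by
  subst ha hb
  rw [heq_iff_eq] at hP hQ
  subst hP hQ
  exact Iff.rfl

/-- On images of telecore-free paths between vertices of `𝒟_{≤4}` the glued set `TGlueE E₀` is `E₀` (only the
`free` constructor applies: abc-iut-w6-d025's `jS_mapPath_injective`, `jS_mapPath_ne_tele`). [folklore] -/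
private theorem tGlueE_jS_iff {E₀ : ∀ ⦃x y : FVtx.{0}⦄, Path x y → Path x y → Prop}
    {α β : SubVertex {a : LFVertex | a.row ≤ 4}}
    (u v : Path (⟨(teleShape anJ.{0}).base α⟩ : FVtx.{0}) ⟨(teleShape anJ.{0}).base β⟩) :
    TGlueE E₀ (jS.mapPath u) (jS.mapPath v) ↔ E₀ u v := by
  refine ⟨fun h => ?_, fun h => TGlueE.free h⟩
  generalize hP : jS.mapPath u = P at h
  generalize hQ : jS.mapPath v = Q at h
  cases h with
  | free h =>
    obtain rfl := jS_mapPath_injective _ _ hP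
    obtain rfl := jS_mapPath_injective _ _ hQ
    exact h
  | tele p q j h => exact absurd hP (jS_mapPath_ne_tele _ _ _ _)

/-- **The master family's pairs in the image of `𝒟_{≤3} ↪ 𝒟_An` are exactly the images of glued pairs of `𝒟`.**
[cite: MochizukiAbsTopIII2015, Corollary 3.6 (iii) p.81] -/
theorem tmaster_E_iff {a b : logObsShape.{0}.Vertex} (p q : Path a b) :
    (tmaster τ).E ((embLogTele anJ.{0}).mapPath p) ((embLogTele anJ.{0}).mapPath q) ↔
      datum.GlueE (embLog.mapPath p) (embLog.mapPath q) := by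
  show TGlueE baseFamily.E _ _ ↔ _
  rw [← jS_mapPath_ell p, ← jS_mapPath_ell q]
  have key : baseFamily.E (ell.mapPath p) (ell.mapPath q) ↔ datum.GlueE (embLog.mapPath p) (embLog.mapPath q) :=
    glueE_heq_iff (embCore5_toCore_ell_obj a) (embCore5_toCore_ell_obj b) (embCore5_toCore_ell_mapPath p)
      (embCore5_toCore_ell_mapPath q)
  rcases a with ⟨α, hα⟩ | _ <;> rcases b with ⟨β, hβ⟩ | _ <;> exact (tGlueE_jS_iff _ _).trans key

/-- Glued image pairs of `𝒟_{≤3}`-pairs are exactly the `E_log` pairs (all targets). [cite: MochizukiAbsTopIII2015, Corollary 3.6 (iii) p.81] -/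
private theorem glueE_embLog_iff_saturation {a b : logObsShape.{0}.Vertex} (p q : Path a b) :
    datum.GlueE (embLog.mapPath p) (embLog.mapPath q) ↔ Saturation datum.LogGen p q := by
  rcases b with ⟨v, hv⟩ | _
  · constructor
    · intro h; exact (datum.glueE_false_of_row_le_two hv h).elim
    · intro h; exact absurd (datum.eq_lvObs_of_saturation_logGen h) (by rintro ⟨⟩)
  · exact ⟨datum.saturation_of_glueE_mapPath p q, datum.glueE_mapPath_of_saturation p q⟩

/-- **The boundary set of the pullback of the master family to `𝒟_{≤3}` is `E_log`** (generated by the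
type-(1)/(2) pairs). [cite: MochizukiAbsTopIII2015, Corollary 3.6 (iii) p.81] -/
theorem pullLogTele_tmaster_E_iff {a b : logObsShape.{0}.Vertex} (p q : Path a b) :
    (datum.pullLogTele (tmaster τ)).E p q ↔ Saturation datum.LogGen p q :=
  (DiagramOfCategories.HomotopyFamily.cast_E_iff _ _ p q).trans ((tmaster_E_iff τ p q).trans
    (glueE_embLog_iff_saturation p q))

/-! ### the pullback of the master family is pinned to `ι_×`, `ι_{log,⋎}` -/

/-- The type-(2) basic pair is a boundary pair of the pullback. [cite: MochizukiAbsTopIII2015, Corollary 3.6 (iii) p.81] -/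
private theorem pullLogTele_E_timesPair :
    (datum.pullLogTele (tmaster τ)).E ((Path.nil : Path lvNexus.{0} lvNexus).cons eLamTimes)
      ((Path.nil : Path lvNexus.{0} lvNexus).cons eLamPf) :=
  (pullLogTele_tmaster_E_iff τ _ _).mpr (Saturation.base LogGen.type2)

/-- The type-(1) basic pairs are boundary pairs of the pullback. [cite: MochizukiAbsTopIII2015, Corollary 3.6 (iii) p.81] -/
private theorem pullLogTele_E_logPair (n : ℤ) :
    (datum.pullLogTele (tmaster τ)).E (logPairLeft.{0} n) (logPairRight.{0} n) :=
  (pullLogTele_tmaster_E_iff τ _ _).mpr (Saturation.base (LogGen.type1 n))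

/-- `𝒟_{≤3,[λ^×]} = (𝒟_An)_{[λ^×]}`. [cite: MochizukiAbsTopIII2015, Corollary 3.6 (iii) p.81] -/
private theorem sub3_pathFunctor_tele_timesLeft :
    datum.sub3.pathFunctor ((Path.nil : Path lvNexus.{0} lvNexus).cons eLamTimes) =
      (TD τ).pathFunctor ((embLogTele anJ.{0}).mapPath ((Path.nil : Path lvNexus.{0} lvNexus).cons eLamTimes)) := by
  simp only [pathFunctor_cons, pathFunctor_nil, Prefunctor.mapPath_cons, Prefunctor.mapPath_nil]
  rfl

/-- `𝒟_{≤3,[λ^{×pf}]} = (𝒟_An)_{[λ^{×pf}]}`. [cite: MochizukiAbsTopIII2015, Corollary 3.6 (iii) p.81] -/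
private theorem sub3_pathFunctor_tele_timesRight :
    datum.sub3.pathFunctor ((Path.nil : Path lvNexus.{0} lvNexus).cons eLamPf) =
      (TD τ).pathFunctor ((embLogTele anJ.{0}).mapPath ((Path.nil : Path lvNexus.{0} lvNexus).cons eLamPf)) := by
  simp only [pathFunctor_cons, pathFunctor_nil, Prefunctor.mapPath_cons, Prefunctor.mapPath_nil]
  rfl

/-- `𝒟_{≤3,[λ^×]∘[id_⋎]∘[log]} = (𝒟_An)_{[λ^×]∘[id_⋎]∘[log]}`. [cite: MochizukiAbsTopIII2015, Corollary 3.6 (iii) p.81] -/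
private theorem sub3_pathFunctor_tele_logLeft (n : ℤ) :
    datum.sub3.pathFunctor (logPairLeft.{0} n) = (TD τ).pathFunctor ((embLogTele anJ.{0}).mapPath (logPairLeft.{0} n)) := by
  simp only [logPairLeft, pathFunctor_cons, pathFunctor_nil, Prefunctor.mapPath_cons, Prefunctor.mapPath_nil]
  rfl

/-- `𝒟_{≤3,[λ^{×pf}]∘[id_{⋎+1}]} = (𝒟_An)_{[λ^{×pf}]∘[id_{⋎+1}]}`. [cite: MochizukiAbsTopIII2015, Corollary 3.6 (iii) p.81] -/
private theorem sub3_pathFunctor_tele_logRight (n : ℤ) :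
    datum.sub3.pathFunctor (logPairRight.{0} n) = (TD τ).pathFunctor ((embLogTele anJ.{0}).mapPath (logPairRight.{0} n)) := by
  simp only [logPairRight, pathFunctor_cons, pathFunctor_nil, Prefunctor.mapPath_cons, Prefunctor.mapPath_nil]
  rfl

/-- Weight of `[λ^×]` in `𝒟_An` is `0`. [cite: MochizukiAbsTopIII2015, Corollary 3.6 (iii) p.81] -/
private theorem tPathWt_embLogTele_timesLeft :
    tPathWt ((embLogTele anJ.{0}).mapPath ((Path.nil : Path lvNexus.{0} lvNexus).cons eLamTimes)) = 0 := by
  simp only [Prefunctor.mapPath_cons, Prefunctor.mapPath_nil]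
  erw [tPathWt_cons, tPathWt_nil]
  rfl

/-- Weight of `[λ^{×pf}]` in `𝒟_An` is `1`. [cite: MochizukiAbsTopIII2015, Corollary 3.6 (iii) p.81] -/
private theorem tPathWt_embLogTele_timesRight :
    tPathWt ((embLogTele anJ.{0}).mapPath ((Path.nil : Path lvNexus.{0} lvNexus).cons eLamPf)) = 1 := by
  simp only [Prefunctor.mapPath_cons, Prefunctor.mapPath_nil]
  erw [tPathWt_cons, tPathWt_nil]
  rfl

/-- Weight of `[λ^×]∘[id_⋎]∘[log]` in `𝒟_An` is `0`. [cite: MochizukiAbsTopIII2015, Corollary 3.6 (iii) p.81] -/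
private theorem tPathWt_embLogTele_logLeft (n : ℤ) : tPathWt ((embLogTele anJ.{0}).mapPath (logPairLeft.{0} n)) = 0 := by
  simp only [logPairLeft, Prefunctor.mapPath_cons, Prefunctor.mapPath_nil]
  erw [tPathWt_cons, tPathWt_cons, tPathWt_cons, tPathWt_nil]
  rfl

/-- Weight of `[λ^{×pf}]∘[id_{⋎+1}]` in `𝒟_An` is `1`. [cite: MochizukiAbsTopIII2015, Corollary 3.6 (iii) p.81] -/
private theorem tPathWt_embLogTele_logRight (n : ℤ) : tPathWt ((embLogTele anJ.{0}).mapPath (logPairRight.{0} n)) = 1 := by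
  simp only [logPairRight, Prefunctor.mapPath_cons, Prefunctor.mapPath_nil]
  erw [tPathWt_cons, tPathWt_cons, tPathWt_nil]
  rfl

/-- The twisted homotopy of the type-(2) basic pair in `𝒟_An` is `g` (`= ι_×`). [cite: MochizukiAbsTopIII2015, Corollary 3.6 (iii) p.81] -/
private theorem tEta_app_timesPair (x : datum.X) :
    (tEta τ ((embLogTele anJ.{0}).mapPath ((Path.nil : Path lvNexus.{0} lvNexus).cons eLamTimes))
      ((embLogTele anJ.{0}).mapPath ((Path.nil : Path lvNexus.{0} lvNexus).cons eLamPf))).app x = (gen : Grp) := by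
  show ofVal LFVertex.third _ _ _ = _
  show Multiplicative.ofAdd _ = _
  rw [tPathWt_embLogTele_timesLeft, tPathWt_embLogTele_timesRight]
  rfl

/-- The twisted homotopy of a type-(1) basic pair in `𝒟_An` is `g` (`= ι_{log,⋎}`). [cite: MochizukiAbsTopIII2015, Corollary 3.6 (iii) p.81] -/
private theorem tEta_app_logPair (n : ℤ) (x : datum.X₁) :
    (tEta τ ((embLogTele anJ.{0}).mapPath (logPairLeft.{0} n)) ((embLogTele anJ.{0}).mapPath (logPairRight.{0} n))).app x =
      (gen : Grp) := by
  show ofVal LFVertex.third _ _ _ = _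
  show Multiplicative.ofAdd _ = _
  rw [tPathWt_embLogTele_logLeft, tPathWt_embLogTele_logRight]
  rfl

/-- Components of heterogeneously equal natural transformations between equal functors agree. [folklore] -/
private theorem heq_app_of_heq' {C D : Type*} [Category C] [Category D] {F G F' G' : C ⥤ D}
    (hF : F = F') (hG : G = G') {α : F ⟶ G} {β : F' ⟶ G'} (h : HEq α β) (X : C) :
    HEq (α.app X) (β.app X) := by
  subst hF hG
  rw [heq_iff_eq] at h
  subst h
  rfl

/-- In a one-object category an `eqToHom`-sandwich of a morphism has the same underlying element. [folklore] -/
private theorem singleObj_sandwich' {M : Type} [Monoid M] {a b c d : CategoryTheory.SingleObj M} (h₁ : a = b)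
    (g : b ⟶ c) (h₂ : c = d) : ((eqToHom h₁ ≫ g ≫ eqToHom h₂ : a ⟶ d) : M) = (g : M) := by
  subst h₁ h₂
  simp

/-- **The pullback of the master family to `𝒟_{≤3}` is pinned to `ι_×`, `ι_{log,⋎}`** (its homotopies on the basic
pairs are those of the master family on the image pairs, i.e. `g`). [cite: MochizukiAbsTopIII2015, Corollary 3.6 (iii) p.81] -/
theorem pullLogTele_tmaster_logPinned : datum.LogPinned (datum.pullLogTele (tmaster τ)) := by
  refine ⟨⟨pullLogTele_E_timesPair τ, fun x e₁ e₂ => ?_⟩,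
    fun n => ⟨pullLogTele_E_logPair τ n, fun x e₁ e₂ => ?_⟩⟩
  · obtain ⟨h', hh⟩ := datum.pullLogTele_compatibleAlong (tmaster τ) _ _ (pullLogTele_E_timesPair τ)
    have H1 : ((datum.pullLogTele (tmaster τ)).η (pullLogTele_E_timesPair τ)).app x =
        (tEta τ ((embLogTele anJ.{0}).mapPath ((Path.nil : Path lvNexus.{0} lvNexus).cons eLamTimes))
          ((embLogTele anJ.{0}).mapPath ((Path.nil : Path lvNexus.{0} lvNexus).cons eLamPf))).app x :=
      eq_of_heq (heq_app_of_heq' (sub3_pathFunctor_tele_timesLeft τ) (sub3_pathFunctor_tele_timesRight τ) hh x)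
    rw [H1]
    exact (tEta_app_timesPair τ x).trans (singleObj_sandwich' e₁ (iotaTimes.app x) e₂.symm).symm
  · obtain ⟨h', hh⟩ := datum.pullLogTele_compatibleAlong (tmaster τ) _ _ (pullLogTele_E_logPair τ n)
    have H1 : ((datum.pullLogTele (tmaster τ)).η (pullLogTele_E_logPair τ n)).app x =
        (tEta τ ((embLogTele anJ.{0}).mapPath (logPairLeft.{0} n)) ((embLogTele anJ.{0}).mapPath (logPairRight.{0} n))).app x :=
      eq_of_heq (heq_app_of_heq' (sub3_pathFunctor_tele_logLeft τ n) (sub3_pathFunctor_tele_logRight τ n) hh x)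
    rw [H1]
    exact (tEta_app_logPair τ n x).trans (singleObj_sandwich' e₁ (iotaLog.app x) e₂.symm).symm

/-- **The pullback of the master family to `𝒟_{≤3}` IS an `𝔖_log` family** (generated by the type-(1)/(2) pairs,
ending at `𝒩`, pinned). [cite: MochizukiAbsTopIII2015, Corollary 3.6 (iii) p.80] -/
theorem pullLogTele_tmaster_isLogObservableFamily : datum.IsLogObservableFamily (datum.pullLogTele (tmaster τ)) :=
  ⟨fun _ _ p q => pullLogTele_tmaster_E_iff τ p q,
    fun _ _ p q h => datum.eq_lvObs_of_saturation_logGen ((pullLogTele_tmaster_E_iff τ p q).mp h),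
    pullLogTele_tmaster_logPinned τ⟩

/-- **The LITERAL Cor. 3.6 (iii) telecore clause HOLDS at the twisted datum, for every telecore datum `τ`.**
[cite: MochizukiAbsTopIII2015, Corollary 3.6 (iii) p.80] -/
theorem logObsCompatTelecoreStmt : datum.LogObsCompatTelecoreStmt τ :=
  ⟨_, _, isCore5, telecore τ, telecore_isTelecoreAn τ, tmaster τ, jfam_compatibleAlong_tmaster τ,
    datum.pullLogTele (tmaster τ), pullLogTele_tmaster_isLogObservableFamily τ,
    datum.pullLogTele_compatibleAlong (tmaster τ)⟩

end TwistedToy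

/-- **ALL THREE typed compatibility clauses of [AbsTopIII] Cor. 3.6 (iii)/(v) hold at one datum where F-0360 fails.**
[cite: MochizukiAbsTopIII2015, Corollary 3.6 (iii) pp.80–81] -/
theorem exists_logObsCompat_all_not_iotaOverGaloisStmt :
    ∃ Δ : LogFrobeniusData.{0}, Δ.LogObsCompatCoresStmt ∧ (∀ τ : Δ.TelecoreData, Δ.LogObsCompatTelecoreStmt τ) ∧
      Δ.ShiftCompatStmt ∧ ¬ Δ.IotaOverGaloisStmt :=
  ⟨TwistedToy.datum, TwistedToy.logObsCompatCoresStmt, TwistedToy.logObsCompatTelecoreStmt,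
    TwistedToy.shiftCompatStmt, TwistedToy.not_iotaOverGaloisStmt⟩

/-- **Schema form for the telecore half.** [cite: MochizukiAbsTopIII2015, Corollary 3.6 (iii) pp.80–81] -/
theorem not_forall_iotaOverGaloisStmt_of_logObsCompatTelecoreStmt :
    ¬ ∀ (Δ : LogFrobeniusData.{0}) (τ : Δ.TelecoreData), Δ.LogObsCompatTelecoreStmt τ → Δ.IotaOverGaloisStmt := by
  intro h
  exact TwistedToy.not_iotaOverGaloisStmt (h _
    ⟨𝟭 _, Functor.leftUnitor _, Functor.rightUnitor _ ≪≫ Functor.rightUnitor _ ≪≫ Functor.rightUnitor _⟩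
    (TwistedToy.logObsCompatTelecoreStmt _))

end LogFrobeniusData

end Literature.AnabelianGeometry.AbsoluteAnabelian
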